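import Summits.QuantumFields.YangMills.Theorems.BalabanUVNodesN15TwoGridDressedLaplacianNoFitFullG
import Summits.QuantumFields.YangMills.Theorems.BalabanUVNodesN15TwoGridDressedDivergenceSupCarrierFullG
import HarnessLib

/-!
# N15 (NE2) — PROGRAMME Λ, part Λ-C: ★★★ `T4EtaRate.NE2PlusOperator` BY NAME, HYPOTHESIS-FREE, FOR BAŁABAN's FULL LANDAU-GAUGE PAIR `(Δ′_a⁻¹, Δ_a⁻¹)` DRESSED BY THE FIRST-ORDER SPECIES
# ON THE (3.35)-PAIR CARRIER `coeffBgFO` — ALL FOUR (3.42) ENTRIES BACKGROUND-LIVE (value, dressed gradient, dressed source divergence, dressed COVARIANT LAPLACIAN)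

WHO ∕ WHEN.  Cell `pub-ymgap`, seat `pub-ymgap-dag-n15-a` (KNIT-BY-NAME seat of Track-A DAG node N15 = NE2, g27); `--supports stmt-QuantumFields-27366 --as helper` (K3⁸; count-neutral).
One plumbing `def` (`foFamilyAllFG`) + theorems.  Over Λ-B `…TwoGridDressedLaplacianNoFitFullG` (★★★ `hasMaj_idef_covLap_gOp`), D-E `…TwoGridDressedDivergenceNoFitFullG` (★★★
`hasMaj_idef_dressedDiv_gOp`), K-J `…TwoGridDressedJetNoFitFullG` (★★ `hasMaj_projO_idef_bgPair_gOp`), D-F `…TwoGridDressedDivergenceSupCarrierFullG` (the pattern), II-E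
`…TwoGridFirstOrderSupCarrier` (`coeffBgFO`, `reg335_coeffBgFO_iff`, `foPairing`, `foOps`, `foInstanceFG`, `foInstanceFG_gf_M`, `osc_rate_le`), n15-b (`one_le_pref4`, `fibreOsc_of_fgrad`),
g0 `etaRateIneq342_of_hasMaj_rateWeight`, `T4EtaRateCoeffDefect.fit_blockAvg` BY NAME; nothing in the tree is modified.

WHY ∕ WHAT.  HANDOFF §g26.5 (t3′), located: «the dressed LAPLACIAN ∕ covariant-Laplacian entry of the pair of record».  Programme Λ (Λ-A identity, Λ-B hypothesis-free) produced it in sup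
currency; this file is the by-name packaging — the pair-of-record analogue of dag-n15-d's K-L `…KingModelSrcDivKnitAllEntries` on the King rung.  §32 `foFamilyAllFG a ν κ` = II-E's `foOps`
at `(Δ_a⁻¹, Δ′_a⁻¹)` with entry 1 := `𝔇(∇′_νX′(U), ∇_νX(Ū))` (K-J, LIVE), entry 2 := `𝔇(X′(U)∇′*_κ, X(Ū)∇*_κ)` (D-E, LIVE), entry 3 := `𝔇((Δ′ − V₁′(U))X′(U), (Δ − V̄₁(Ū))X(Ū))` — THE
DRESSED COVARIANT LAPLACIAN of the pair of record (Λ-B, LIVE), entry 0 = the dressed values (LIVE); §33 ★★★ `ne2PlusOperator_allEntries_fullG (hLodd) (hL3 : 3 ≤ L) (hL) (ha) (c₃₅) (hc₃₅)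
(ν κ) : NE2PlusOperator c₃₅ (foInstanceFG d hL) (foFamilyAllFG d hL a ν κ)` — HYPOTHESIS-FREE (`M₅ = 1`, `a₀ = min(r₀, r₀′, r₀″)∕c₃₅`, `γ₀ = min(1∕16, 1∕(8(d+1)))`), ★★
`ne2ZeroOperator_allEntries_fullG`.

HONEST FRAMING ∕ LIMITS.  All four entries carry the configuration genuinely, IN THE ABELIANISED SCALAR-MULTIPLIER MODEL of (3.52)'s `V′(A)` with block-averaged coarse partner (C3):
«covariant Laplacian» := `Δ − V₁` (`V₁ = M_c + Σ_μ M_{a_μ}∇_μ`), «covariant divergence» := the flat `∇*_κ` — Bałaban's `Δ_U`, `D*_U` of (3.50) differ by the non-abelian (matrix ∕ shift)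
dressing (n15-c's lane, located); `U ≡ 1` Landau-gauge pair on the torus family of record, NOT Bałaban's `G(U)` for general `U`; NE2⁺ as printed NOT PRINTED ∕ NOT proved; no statement of
record touched; N15 NOT discharged; K3⁸ OPEN; counts UNMOVED (typed 28∕28 · discharged 6∕28 of record); one finite torus per index — NOT ℝ⁴ ∕ infinite volume ∕ OS ∕ mass gap ∕ Clay.  ONE
declared `set_option maxHeartbeats 1600000 in` on ★★★ (four-entry readout over long operator terms).
-/

noncomputable section

open scoped BigOperators
open Finset

namespace Summit.QuantumFields.YangMills.BalabanUVNodes.N15.TwoGrid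

open Literature.MathematicalPhysics.QuantumFieldTheory.Balaban1983to89
open Literature.MathematicalPhysics.QuantumFieldTheory.Balaban1983to89.B11SectG (BlockNorm HasMaj)
open Literature.MathematicalPhysics.QuantumFieldTheory.Balaban1983to89.T4EtaRate (PairedInstance EtaPairing EtaRateIneq342 NE2PlusOperator NE2ZeroOperator ne2Zero_of_ne2Plus)
open Literature.MathematicalPhysics.QuantumFieldTheory.Balaban1983to89.T4EtaRateDefect (idef rateWeight)
open Literature.MathematicalPhysics.QuantumFieldTheory.Balaban1983to89.T4EtaRateCoeffDefect (pull blockAvg fit_blockAvg)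
open Literature.MathematicalPhysics.QuantumFieldTheory.Balaban1983to89.B5Prop11Plancherel (Tor fine unitVec)
open Literature.MathematicalPhysics.QuantumFieldTheory.Balaban1983to89.B5SiteBridgeP12 (MP)
open Literature.MathematicalPhysics.QuantumFieldTheory.King1986.Torus (blockOf tdistT tdistT_nonneg)
open Literature.MathematicalPhysics.QuantumFieldTheory.Balaban1983to89.B6UnitTorusCarrier (unitTorusGeo)
open Summit.QuantumFields.YangMills.BalabanUVNodes.N15.VectorPiece (blkFine kingPrV blkFine_comp_kingPrV unitTorusGeoS rateWeight_unitTorusGeoS bshiftEquiv bshiftEquiv_apply)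
open Summit.QuantumFields.YangMills.BalabanUVNodes.N15.OperatorReadout (opGeo opFamily opGeo_len etaRateIneq342_of_hasMaj_rateWeight)
open Summit.QuantumFields.YangMills.BalabanUVNodes.N15.BackgroundLayer (bgPair projO unstack fineGeo one_le_pref4 abs_le_iSup_abs avg₁ avg₁_zero fgrad fgrad_apply fibreOsc_of_fgrad)
open Summit.QuantumFields.YangMills.BalabanUVNodes.N15.GenuineRecord (TGIndexS tgIndexS_cofinal)

variable {d : ℕ}

/-! ## §32 The family with all four entries of the pair of record live -/

section Sized

variable (d) {L : ℕ} [NeZero L]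

/-- THE KERNEL FAMILY at a sized index: II-E's `foOps` at Bałaban's `G := Δ_a⁻¹`, `G′ := Δ′_a⁻¹` with ENTRY 1 := THE DRESSED GRADIENT `𝔇(∇′_νX′(U), ∇_νX(Ū))` (K-J — LIVE), ENTRY 2 := THE DRESSED
SOURCE DIVERGENCE `𝔇(X′(U)∇′*_κ, X(Ū)∇*_κ)` (D-E — LIVE), ENTRY 3 := THE DRESSED COVARIANT LAPLACIAN `𝔇((Δ′ − V₁′(U))X′(U), (Δ − V̄₁(Ū))X(Ū))` (Λ-B — LIVE), read through `opFamily`.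
[cite: Balaban1985BackgroundPropagators, (3.42) p.397 (the four entries: shape), (3.52) p.400, (3.62)–(3.65) pp.402–403 (mechanism)] -/
def foFamilyAllFG (hL : Odd L ∧ 1 < L) (a : ℝ) (ν κ : Fin (d + 1)) (j : TGIndexS) : B9.KernelFamily (foInstanceFG d hL j).gc (foInstanceFG d hL j).Bf :=
  show B9.KernelFamily (opGeo (unitTorusGeoS L j.k (TGIndex.Mn d hL j.toTGIndex) j.Msz) (Tor (fine (L ^ j.k) (TGIndex.Mn d hL j.toTGIndex)) × Fin (d + 1))
      (blkFine L j.k (TGIndex.Mn d hL j.toTGIndex))) (coeffBgFO (TGIndex.Mn d hL j.toTGIndex) (L ^ j.m * L ^ j.k) j.Msz) from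
    opFamily (g := unitTorusGeoS L j.k (TGIndex.Mn d hL j.toTGIndex) j.Msz) (B := coeffBgFO (TGIndex.Mn d hL j.toTGIndex) (L ^ j.m * L ^ j.k) j.Msz)
      (blkFine L j.k (TGIndex.Mn d hL j.toTGIndex)) (blkFine L j.k (TGIndex.Mn d hL j.toTGIndex) ∘ kingPrV L j.k j.m (TGIndex.Mn d hL j.toTGIndex))
      (foOps (TGIndex.Mn d hL j.toTGIndex) j.k j.m j.Msz (gOp (TGIndex.Mn d hL j.toTGIndex) (L ^ j.k) a) (gOp (TGIndex.Mn d hL j.toTGIndex) (L ^ j.m * L ^ j.k) a)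
        fun n U => ![
          idef (pull (kingPrV L j.k j.m (TGIndex.Mn d hL j.toTGIndex))) (pull (kingPrV L j.k j.m (TGIndex.Mn d hL j.toTGIndex)))
            (projO (some ν) ∘ₗ bgPair (gOp (TGIndex.Mn d hL j.toTGIndex) (L ^ j.m * L ^ j.k) a)
              (fun μ' => symbOp (TGIndex.Mn d hL j.toTGIndex) (L ^ j.m * L ^ j.k) (sD (TGIndex.Mn d hL j.toTGIndex) (L ^ j.m * L ^ j.k) μ' ((L ^ j.m * L ^ j.k : ℕ) : ℝ)) ∘ₗ
                gOp (TGIndex.Mn d hL j.toTGIndex) (L ^ j.m * L ^ j.k) a) U.1 U.2)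
            (projO (some ν) ∘ₗ bgPair (gOp (TGIndex.Mn d hL j.toTGIndex) (L ^ j.k) a)
              (fun μ' => symbOp (TGIndex.Mn d hL j.toTGIndex) (L ^ j.k) (sD (TGIndex.Mn d hL j.toTGIndex) (L ^ j.k) μ' ((L ^ j.k : ℕ) : ℝ)) ∘ₗ gOp (TGIndex.Mn d hL j.toTGIndex) (L ^ j.k) a)
              (blockAvg (kingPrV L j.k j.m (TGIndex.Mn d hL j.toTGIndex)) U.1) (fun μ' => blockAvg (kingPrV L j.k j.m (TGIndex.Mn d hL j.toTGIndex)) (U.2 μ'))),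
          idef (pull (kingPrV L j.k j.m (TGIndex.Mn d hL j.toTGIndex))) (pull (kingPrV L j.k j.m (TGIndex.Mn d hL j.toTGIndex)))
            ((projO none ∘ₗ bgPair (gOp (TGIndex.Mn d hL j.toTGIndex) (L ^ j.m * L ^ j.k) a)
              (fun μ' => symbOp (TGIndex.Mn d hL j.toTGIndex) (L ^ j.m * L ^ j.k) (sD (TGIndex.Mn d hL j.toTGIndex) (L ^ j.m * L ^ j.k) μ' ((L ^ j.m * L ^ j.k : ℕ) : ℝ)) ∘ₗ
                gOp (TGIndex.Mn d hL j.toTGIndex) (L ^ j.m * L ^ j.k) a) U.1 U.2) ∘ₗ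
              symbOp (TGIndex.Mn d hL j.toTGIndex) (L ^ j.m * L ^ j.k) (((L ^ j.m * L ^ j.k : ℕ) : ℝ) • (sTinv (TGIndex.Mn d hL j.toTGIndex) (L ^ j.m * L ^ j.k) κ - 1)))
            ((projO none ∘ₗ bgPair (gOp (TGIndex.Mn d hL j.toTGIndex) (L ^ j.k) a)
              (fun μ' => symbOp (TGIndex.Mn d hL j.toTGIndex) (L ^ j.k) (sD (TGIndex.Mn d hL j.toTGIndex) (L ^ j.k) μ' ((L ^ j.k : ℕ) : ℝ)) ∘ₗ gOp (TGIndex.Mn d hL j.toTGIndex) (L ^ j.k) a)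
              (blockAvg (kingPrV L j.k j.m (TGIndex.Mn d hL j.toTGIndex)) U.1) (fun μ' => blockAvg (kingPrV L j.k j.m (TGIndex.Mn d hL j.toTGIndex)) (U.2 μ'))) ∘ₗ
              symbOp (TGIndex.Mn d hL j.toTGIndex) (L ^ j.k) (((L ^ j.k : ℕ) : ℝ) • (sTinv (TGIndex.Mn d hL j.toTGIndex) (L ^ j.k) κ - 1))),
          idef (pull (kingPrV L j.k j.m (TGIndex.Mn d hL j.toTGIndex))) (pull (kingPrV L j.k j.m (TGIndex.Mn d hL j.toTGIndex)))
            (symbOp (TGIndex.Mn d hL j.toTGIndex) (L ^ j.m * L ^ j.k) (sLap (TGIndex.Mn d hL j.toTGIndex) (L ^ j.m * L ^ j.k) ((L ^ j.m * L ^ j.k : ℕ) : ℝ)) ∘ₗ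
                (projO none ∘ₗ bgPair (gOp (TGIndex.Mn d hL j.toTGIndex) (L ^ j.m * L ^ j.k) a)
                  (fun μ' => symbOp (TGIndex.Mn d hL j.toTGIndex) (L ^ j.m * L ^ j.k) (sD (TGIndex.Mn d hL j.toTGIndex) (L ^ j.m * L ^ j.k) μ' ((L ^ j.m * L ^ j.k : ℕ) : ℝ)) ∘ₗ
                    gOp (TGIndex.Mn d hL j.toTGIndex) (L ^ j.m * L ^ j.k) a) U.1 U.2)
              - unstack U.1 U.2 ∘ₗ bgPair (gOp (TGIndex.Mn d hL j.toTGIndex) (L ^ j.m * L ^ j.k) a)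
                  (fun μ' => symbOp (TGIndex.Mn d hL j.toTGIndex) (L ^ j.m * L ^ j.k) (sD (TGIndex.Mn d hL j.toTGIndex) (L ^ j.m * L ^ j.k) μ' ((L ^ j.m * L ^ j.k : ℕ) : ℝ)) ∘ₗ
                    gOp (TGIndex.Mn d hL j.toTGIndex) (L ^ j.m * L ^ j.k) a) U.1 U.2)
            (symbOp (TGIndex.Mn d hL j.toTGIndex) (L ^ j.k) (sLap (TGIndex.Mn d hL j.toTGIndex) (L ^ j.k) ((L ^ j.k : ℕ) : ℝ)) ∘ₗ
                (projO none ∘ₗ bgPair (gOp (TGIndex.Mn d hL j.toTGIndex) (L ^ j.k) a)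
                  (fun μ' => symbOp (TGIndex.Mn d hL j.toTGIndex) (L ^ j.k) (sD (TGIndex.Mn d hL j.toTGIndex) (L ^ j.k) μ' ((L ^ j.k : ℕ) : ℝ)) ∘ₗ gOp (TGIndex.Mn d hL j.toTGIndex) (L ^ j.k) a)
                  (blockAvg (kingPrV L j.k j.m (TGIndex.Mn d hL j.toTGIndex)) U.1) (fun μ' => blockAvg (kingPrV L j.k j.m (TGIndex.Mn d hL j.toTGIndex)) (U.2 μ')))
              - unstack (blockAvg (kingPrV L j.k j.m (TGIndex.Mn d hL j.toTGIndex)) U.1) (fun μ' => blockAvg (kingPrV L j.k j.m (TGIndex.Mn d hL j.toTGIndex)) (U.2 μ')) ∘ₗ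
                  bgPair (gOp (TGIndex.Mn d hL j.toTGIndex) (L ^ j.k) a)
                    (fun μ' => symbOp (TGIndex.Mn d hL j.toTGIndex) (L ^ j.k) (sD (TGIndex.Mn d hL j.toTGIndex) (L ^ j.k) μ' ((L ^ j.k : ℕ) : ℝ)) ∘ₗ gOp (TGIndex.Mn d hL j.toTGIndex) (L ^ j.k) a)
                    (blockAvg (kingPrV L j.k j.m (TGIndex.Mn d hL j.toTGIndex)) U.1) (fun μ' => blockAvg (kingPrV L j.k j.m (TGIndex.Mn d hL j.toTGIndex)) (U.2 μ')))] n)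

end Sized

/-! ## §33 ★★★ `NE2PlusOperator` BY NAME, all four entries background-live, hypothesis-free, pair of record -/

section Main

variable (d) {L : ℕ} [NeZero L]

set_option maxHeartbeats 1600000 in
/-- ★★★ **NE2⁺, OPERATOR LAYER — `T4EtaRate.NE2PlusOperator` BY NAME, HYPOTHESIS-FREE, FOR BAŁABAN's FULL PAIR DRESSED BY THE FIRST-ORDER SPECIES ON THE (3.35)-PAIR CARRIER, WITH ALL FOUR
(3.42) ENTRIES — VALUE, GRADIENT, SOURCE DIVERGENCE, COVARIANT LAPLACIAN — BACKGROUND-LIVE.**  For odd `L ≥ 3`, `a > 0`, `c₃₅ > 0`, directions `ν, κ`: `NE2PlusOperator c₃₅ (foInstanceFG d hL)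
(foFamilyAllFG d hL a ν κ)`.  (3.35) is consumed as the sups of `c′`, `a′_μ` and of the first quotients of `a′` — NOTHING on `∇c′`, NOTHING on `∇∇a′`; entries 0–1 = K-J ★★ (fit of `a′` derived),
entry 2 = D-E ★★★, entry 3 = Λ-B ★★★; `γ₀ = min(1∕16, 1∕(8(d+1)))`. [cite: Balaban1985BackgroundPropagators, Thm 3.1 p.397 (quantifier template), (3.35) p.396, (3.42) p.397, (3.52) p.400,
(3.62)–(3.65) pp.402–403 (shapes, mechanism); Balaban1984PropagatorsI, (1.69)–(1.73) pp.29–30, Prop. 1.2 (1.110)–(1.111) p.35; King1986, Prop. 3.9 (3.73) p.665 (rate factor)] -/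
theorem ne2PlusOperator_allEntries_fullG (hLodd : Odd L) (hL3 : 3 ≤ L) (hL : Odd L ∧ 1 < L) {a : ℝ} (ha : 0 < a) (c35 : ℝ) (hc35 : 0 < c35) (ν κ : Fin (d + 1)) :
    NE2PlusOperator c35 (foInstanceFG d hL) (foFamilyAllFG d hL a ν κ) := by
  have hL1 : (1 : ℝ) ≤ (L : ℝ) := by exact_mod_cast (show 1 ≤ L by omega)
  have hLr : (0 : ℝ) < (L : ℝ) := by positivity
  set γ₀ : ℝ := min (1 / 16) (1 / (8 * ((d : ℝ) + 1))) with hγ₀def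
  have hd8 : (0 : ℝ) < 1 / (8 * ((d : ℝ) + 1)) := by positivity
  have hγ₀ : 0 < γ₀ := lt_min (by norm_num) hd8
  have hγ₀le : γ₀ ≤ 1 / 16 := min_le_left _ _
  have hγ₀le' : γ₀ ≤ 1 / (8 * ((d : ℝ) + 1)) := min_le_right _ _
  -- entries 0–1: K-J; entry 2: D-E; entry 3: Λ-B
  obtain ⟨δE, r₀, B, hδE, hr₀, hB, HJ⟩ := hasMaj_projO_idef_bgPair_gOp d hLodd hL3 ha
  obtain ⟨δD, r₁, BD, hδD, hr₁, hBD, HD⟩ := hasMaj_idef_dressedDiv_gOp d hLodd hL3 ha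
  obtain ⟨δΛ, r₂, BΛ, hδΛ, hr₂, hBΛ, HΛ⟩ := hasMaj_idef_covLap_gOp d hLodd hL3 ha
  set rm : ℝ := min (min r₀ r₁) r₂ with hrm_def
  have hrm : 0 < rm := lt_min (lt_min hr₀ hr₁) hr₂
  have hrm₀ : rm ≤ r₀ := (min_le_left _ _).trans (min_le_left _ _)
  have hrm₁ : rm ≤ r₁ := (min_le_left _ _).trans (min_le_right _ _)
  have hrm₂ : rm ≤ r₂ := min_le_right _ _
  set δ₀ : ℝ := min (min δE δD) δΛ with hδ₀def
  have hδ₀ : 0 < δ₀ := lt_min (lt_min hδE hδD) hδΛ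
  set BJ : ℝ := max B BΛ * (1 + rm + 2 * ((d : ℝ) + 1) * rm) with hBJdef
  have hBmax : 0 < max B BΛ := hB.trans_le (le_max_left _ _)
  have hBJ : 0 < BJ := by positivity
  set B₀ : ℝ := max BJ BD with hB₀def
  have hB₀ : 0 < B₀ := hBJ.trans_le (le_max_left _ _)
  refine ⟨1, δ₀, rm / c35, B₀, γ₀, one_pos, hδ₀, by positivity, hB₀, hγ₀, fun j _hM α₀ hα₀ hMα U hU => ?_⟩
  -- at the index `j`: the letters of the configuration
  obtain ⟨hU1, hU2, hU3⟩ := (reg335_coeffBgFO_iff (TGIndex.Mn d hL j.toTGIndex) (L ^ j.m * L ^ j.k) j.Msz c35 α₀ U).1 hU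
  have hMsz : (0 : ℝ) ≤ j.Msz := zero_le_one.trans j.one_le_Msz
  have hr0 : 0 ≤ c35 * j.Msz * α₀ := by positivity
  have hrrm : c35 * j.Msz * α₀ ≤ rm := by
    have h := mul_le_mul_of_nonneg_left hMα hc35.le
    rw [foInstanceFG_gf_M, mul_div_cancel₀ _ hc35.ne'] at h
    linarith [h]
  have hrr₀ : c35 * j.Msz * α₀ ≤ r₀ := hrrm.trans hrm₀
  have hrr₁ : c35 * j.Msz * α₀ ≤ r₁ := hrrm.trans hrm₁
  have hrr₂ : c35 * j.Msz * α₀ ≤ r₂ := hrrm.trans hrm₂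
  have hn' : (0 : ℝ) < ((L ^ j.m * L ^ j.k : ℕ) : ℝ) := by positivity
  have hfa : ∀ μ' z, |U.2 μ' z - blockAvg (kingPrV L j.k j.m (TGIndex.Mn d hL j.toTGIndex)) (U.2 μ') (kingPrV L j.k j.m (TGIndex.Mn d hL j.toTGIndex) z)| ≤
      ((2 * ((d + 1) * (L ^ j.m - 1)) : ℕ) : ℝ) * (c35 * j.Msz * α₀ / ((L ^ j.m * L ^ j.k : ℕ) : ℝ)) :=
    fun μ' z => fit_blockAvg _ (fibreOsc_of_fgrad L j.k j.m (TGIndex.Mn d hL j.toTGIndex) hn' fun κ' z => hU3 μ' κ' z) z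
  have hoa : 0 ≤ ((2 * ((d + 1) * (L ^ j.m - 1)) : ℕ) : ℝ) * (c35 * j.Msz * α₀ / ((L ^ j.m * L ^ j.k : ℕ) : ℝ)) := by positivity
  have hJ := HJ j.mT j.k j.m j.one_le hL _ hr0 hrr₀ _ hoa U.1 U.2 hU1 hU2 hfa
  have hDiv := HD j.mT j.k j.m j.one_le hL κ _ hr0 hrr₁ U.1 U.2 hU1 hU2 hU3
  have hLap := HΛ j.mT j.k j.m j.one_le hL _ hr0 hrr₂ _ hoa U.1 U.2 hU1 hU2 hfa
  -- the readout
  have hη : 0 < (unitTorusGeoS L j.k (TGIndex.Mn d hL j.toTGIndex) j.Msz).eta := inv_pos.mpr (pow_pos hLr _)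
  have hblk : blkFine L j.k (TGIndex.Mn d hL j.toTGIndex) ∘ kingPrV L j.k j.m (TGIndex.Mn d hL j.toTGIndex) =
      fun i : Tor (fine (L ^ j.m * L ^ j.k) (TGIndex.Mn d hL j.toTGIndex)) × Fin (d + 1) => blockOf (L ^ j.m * L ^ j.k) (TGIndex.Mn d hL j.toTGIndex) i.1 :=
    blkFine_comp_kingPrV (TGIndex.Mn d hL j.toTGIndex) L j.k j.m
  unfold foFamilyAllFG
  rw [hblk]
  have hrw : ∀ y' : Tor (TGIndex.Mn d hL j.toTGIndex), rateWeight (unitTorusGeoS L j.k (TGIndex.Mn d hL j.toTGIndex) j.Msz) γ₀ y' = ((L : ℝ) ^ j.k) ^ (-γ₀) :=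
    fun y' => rateWeight_unitTorusGeoS L (TGIndex.Mn d hL j.toTGIndex) j.k j.Msz γ₀ y'
  have hcast : ((L ^ j.k : ℕ) : ℝ) = (L : ℝ) ^ j.k := by push_cast; ring
  have hx1 : (1 : ℝ) ≤ (L : ℝ) ^ j.k := one_le_pow₀ hL1
  -- absorptions: `(L^k)^{−1∕16}, (L^k)^{−1∕(8(d+1))} ≤ (L^k)^{−γ₀}`, `r ≤ rm`, the derived fit `≤ 2(d+1)rm(L^k)^{−γ₀}`
  have h16 : ((L ^ j.k : ℕ) : ℝ) ^ (-(1 / 16 : ℝ)) ≤ ((L : ℝ) ^ j.k) ^ (-γ₀) := by rw [hcast]; exact Real.rpow_le_rpow_of_exponent_le hx1 (by linarith)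
  have h8 : ((L ^ j.k : ℕ) : ℝ) ^ (-(1 / (8 * ((d : ℝ) + 1)))) ≤ ((L : ℝ) ^ j.k) ^ (-γ₀) := by rw [hcast]; exact Real.rpow_le_rpow_of_exponent_le hx1 (by linarith)
  have hθeq : ((L ^ j.k : ℕ) : ℝ) ^ (-(min (1 / 16 : ℝ) (1 / (8 * ((d : ℝ) + 1))))) = ((L : ℝ) ^ j.k) ^ (-γ₀) := by rw [hcast]
  have hθ : 0 ≤ ((L : ℝ) ^ j.k) ^ (-γ₀) := Real.rpow_nonneg (pow_nonneg hLr.le _) _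
  have hosc := osc_rate_le (d := d) j.k j.m hL1 (γ := γ₀) hr0 hrrm (by linarith)
  have hsum : ((L ^ j.k : ℕ) : ℝ) ^ (-(1 / 16 : ℝ)) + (c35 * j.Msz * α₀) * ((L ^ j.k : ℕ) : ℝ) ^ (-(1 / (8 * ((d : ℝ) + 1)))) +
      ((2 * ((d + 1) * (L ^ j.m - 1)) : ℕ) : ℝ) * (c35 * j.Msz * α₀ / ((L ^ j.m * L ^ j.k : ℕ) : ℝ)) ≤ (1 + rm + 2 * ((d : ℝ) + 1) * rm) * ((L : ℝ) ^ j.k) ^ (-γ₀) := by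
    have hmid : (c35 * j.Msz * α₀) * ((L ^ j.k : ℕ) : ℝ) ^ (-(1 / (8 * ((d : ℝ) + 1)))) ≤ rm * ((L : ℝ) ^ j.k) ^ (-γ₀) :=
      mul_le_mul hrrm h8 (Real.rpow_nonneg (by positivity) _) hrm.le
    linarith [hosc, hmid, h16]
  have hexp : ∀ {t : ℝ} (y y' : Tor (TGIndex.Mn d hL j.toTGIndex)), δ₀ ≤ t →
      Real.exp (-(t * tdistT (TGIndex.Mn d hL j.toTGIndex) y y')) ≤ Real.exp (-(δ₀ * tdistT (TGIndex.Mn d hL j.toTGIndex) y y')) :=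
    fun y y' ht => Real.exp_le_exp.mpr (by nlinarith [tdistT_nonneg (TGIndex.Mn d hL j.toTGIndex) y y'])
  have hδ₀E : δ₀ ≤ δE := (min_le_left _ _).trans (min_le_left _ _)
  have hδ₀D : δ₀ ≤ δD := (min_le_left _ _).trans (min_le_right _ _)
  have hδ₀Λ : δ₀ ≤ δΛ := min_le_right _ _
  -- the common K-J ∕ Λ-B shape ⇒ the readout shape
  have hshape : ∀ {Top : (Tor (fine (L ^ j.k) (TGIndex.Mn d hL j.toTGIndex)) × Fin (d + 1) → ℝ) →ₗ[ℝ] (Tor (fine (L ^ j.m * L ^ j.k) (TGIndex.Mn d hL j.toTGIndex)) × Fin (d + 1) → ℝ)}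
      {Bx δx : ℝ}, 0 < Bx → Bx ≤ max B BΛ → δ₀ ≤ δx →
      HasMaj (BlockNorm.ofBlocks (unitTorusGeoS L j.k (TGIndex.Mn d hL j.toTGIndex) j.Msz) (blkFine L j.k (TGIndex.Mn d hL j.toTGIndex)))
        (BlockNorm.ofBlocks (unitTorusGeoS L j.k (TGIndex.Mn d hL j.toTGIndex) j.Msz) (fun i : Tor (fine (L ^ j.m * L ^ j.k) (TGIndex.Mn d hL j.toTGIndex)) × Fin (d + 1) => blockOf (L ^ j.m * L ^ j.k) (TGIndex.Mn d hL j.toTGIndex) i.1))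
        Top (fun y y' => Bx * (((L ^ j.k : ℕ) : ℝ) ^ (-(1 / 16 : ℝ)) + c35 * j.Msz * α₀ * ((L ^ j.k : ℕ) : ℝ) ^ (-(1 / (8 * ((d : ℝ) + 1)))) +
            ((2 * ((d + 1) * (L ^ j.m - 1)) : ℕ) : ℝ) * (c35 * j.Msz * α₀ / ((L ^ j.m * L ^ j.k : ℕ) : ℝ))) * Real.exp (-(δx * tdistT (TGIndex.Mn d hL j.toTGIndex) y y'))) →
      HasMaj (BlockNorm.ofBlocks (unitTorusGeoS L j.k (TGIndex.Mn d hL j.toTGIndex) j.Msz) (blkFine L j.k (TGIndex.Mn d hL j.toTGIndex)))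
        (BlockNorm.ofBlocks (unitTorusGeoS L j.k (TGIndex.Mn d hL j.toTGIndex) j.Msz) (fun i : Tor (fine (L ^ j.m * L ^ j.k) (TGIndex.Mn d hL j.toTGIndex)) × Fin (d + 1) => blockOf (L ^ j.m * L ^ j.k) (TGIndex.Mn d hL j.toTGIndex) i.1))
        Top (fun y y' => BJ * Real.exp (-(δ₀ * tdistT (TGIndex.Mn d hL j.toTGIndex) y y')) * rateWeight (unitTorusGeoS L j.k (TGIndex.Mn d hL j.toTGIndex) j.Msz) γ₀ y') := by
    intro Top Bx δx hBx hBxle hδx h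
    refine h.mono fun y y' => ?_
    rw [hrw]
    have hE := Real.exp_nonneg (-(δx * tdistT (TGIndex.Mn d hL j.toTGIndex) y y'))
    calc Bx * (((L ^ j.k : ℕ) : ℝ) ^ (-(1 / 16 : ℝ)) + c35 * j.Msz * α₀ * ((L ^ j.k : ℕ) : ℝ) ^ (-(1 / (8 * ((d : ℝ) + 1)))) +
            ((2 * ((d + 1) * (L ^ j.m - 1)) : ℕ) : ℝ) * (c35 * j.Msz * α₀ / ((L ^ j.m * L ^ j.k : ℕ) : ℝ))) * Real.exp (-(δx * tdistT (TGIndex.Mn d hL j.toTGIndex) y y'))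
        ≤ max B BΛ * ((1 + rm + 2 * ((d : ℝ) + 1) * rm) * ((L : ℝ) ^ j.k) ^ (-γ₀)) * Real.exp (-(δ₀ * tdistT (TGIndex.Mn d hL j.toTGIndex) y y')) :=
          mul_le_mul (mul_le_mul hBxle hsum (by positivity) hBmax.le) (hexp y y' hδx) hE (by positivity)
      _ = BJ * Real.exp (-(δ₀ * tdistT (TGIndex.Mn d hL j.toTGIndex) y y')) * ((L : ℝ) ^ j.k) ^ (-γ₀) := by rw [hBJdef]; ring
  refine etaRateIneq342_of_hasMaj_rateWeight (g := unitTorusGeoS L j.k (TGIndex.Mn d hL j.toTGIndex) j.Msz) (B := coeffBgFO (TGIndex.Mn d hL j.toTGIndex) (L ^ j.m * L ^ j.k) j.Msz)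
    (blkFine L j.k (TGIndex.Mn d hL j.toTGIndex)) (fun i : Tor (fine (L ^ j.m * L ^ j.k) (TGIndex.Mn d hL j.toTGIndex)) × Fin (d + 1) => blockOf (L ^ j.m * L ^ j.k) (TGIndex.Mn d hL j.toTGIndex) i.1)
    hη hLr hB₀.le (c := ![BJ, BJ, BD, BJ]) (fun n => by fin_cases n <;> simp <;> positivity) (fun n y => ?_) _ U fun n => ?_
  · -- `c n ≤ B₀ ≤ B₀·pref4`
    have hlen : 1 ≤ (unitTorusGeoS L j.k (TGIndex.Mn d hL j.toTGIndex) j.Msz).len y := by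
      show (1 : ℝ) ≤ (L : ℝ) ^ j.k * (((L : ℝ) ^ j.k)⁻¹)
      rw [mul_inv_cancel₀ (pow_ne_zero _ hLr.ne')]
    have hpref := one_le_pref4 hlen n
    have hcn : (![BJ, BJ, BD, BJ] : Fin 4 → ℝ) n ≤ B₀ := by
      fin_cases n
      · exact le_max_left _ _
      · exact le_max_left _ _
      · exact le_max_right _ _
      · exact le_max_left _ _
    calc _ ≤ B₀ := hcn
      _ = B₀ * 1 := (mul_one _).symm
      _ ≤ _ := mul_le_mul_of_nonneg_left hpref hB₀.le
  · fin_cases n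
    · exact hshape hB (le_max_left _ _) hδ₀E (hJ none)
    · exact hshape hB (le_max_left _ _) hδ₀E (hJ (some ν))
    · -- entry 2: the dressed source divergence (D-E)
      refine hDiv.mono fun y y' => ?_
      rw [hrw, hθeq]
      have hE := Real.exp_nonneg (-(δD * tdistT (TGIndex.Mn d hL j.toTGIndex) y y'))
      calc BD * ((L : ℝ) ^ j.k) ^ (-γ₀) * Real.exp (-(δD * tdistT (TGIndex.Mn d hL j.toTGIndex) y y'))
          ≤ BD * ((L : ℝ) ^ j.k) ^ (-γ₀) * Real.exp (-(δ₀ * tdistT (TGIndex.Mn d hL j.toTGIndex) y y')) := mul_le_mul_of_nonneg_left (hexp y y' hδ₀D) (by positivity)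
        _ = _ := by simp; ring
    · -- entry 3: the dressed covariant Laplacian (Λ-B)
      exact hshape hBΛ (le_max_right _ _) hδ₀Λ hLap

/-- ★★ **NE2⁰ FOR THE SAME FAMILY — `T4EtaRate.NE2ZeroOperator` BY NAME**: the trivial family `U = 0` is regular for every `α₀ > 0` under the guard, so `ne2Zero_of_ne2Plus` applies.
[cite: Balaban1985BackgroundPropagators, Thm 3.1 p.397 (quantifier template); King1986, Props. 3.8–3.9 (3.71)–(3.75) pp.664–665 (rate shape)] -/
theorem ne2ZeroOperator_allEntries_fullG (hLodd : Odd L) (hL3 : 3 ≤ L) (hL : Odd L ∧ 1 < L) {a : ℝ} (ha : 0 < a) {c35 : ℝ} (hc35 : 0 < c35) (ν κ : Fin (d + 1)) :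
    NE2ZeroOperator (foInstanceFG d hL) (foFamilyAllFG d hL a ν κ) := by
  refine ne2Zero_of_ne2Plus (c35 := c35) (fun j α₀ hα₀ => ?_) (ne2PlusOperator_allEntries_fullG d hLodd hL3 hL ha c35 hc35 ν κ)
  have hM : (0 : ℝ) ≤ j.Msz := zero_le_one.trans j.one_le_Msz
  have h0 : (0 : ℝ) ≤ c35 * j.Msz * α₀ := by positivity
  refine (reg335_coeffBgFO_iff (TGIndex.Mn d hL j.toTGIndex) (L ^ j.m * L ^ j.k) j.Msz c35 α₀ _).2 ⟨fun z => ?_, fun μ' z => ?_, fun μ' κ' z => ?_⟩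
  · show |(0 : ℝ)| ≤ _; rw [abs_zero]; exact h0
  · show |(0 : ℝ)| ≤ _; rw [abs_zero]; exact h0
  · rw [fgrad_apply]
    show |((L ^ j.m * L ^ j.k : ℕ) : ℝ) * ((0 : ℝ) - 0)| ≤ _
    rw [sub_zero, mul_zero, abs_zero]; exact h0

end Main

end Summit.QuantumFields.YangMills.BalabanUVNodes.N15.TwoGrid

end
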